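import Summits.BirchSwinnertonDyer.Rank1Residual.ManinAdditive.CongruenceExcessLaws
import Literature.NumberTheory.EllipticCurves.ManinConstantKodairaTypePrimes
import HarnessLib

/-!
# Placement edges for the congruence-excess leaves E-desc-14 … E-desc-18 (cell `bsd-f2-manin`)

PROVED, elementary edges between the `@[conjecture]` leaves of
`Summits/BirchSwinnertonDyer/Rank1Residual/ManinAdditive/CongruenceExcessLaws.lean`
(`TameRigidManinLaw`, `TameRigidNoExcess`, `DyadicRigidExcessLaw`, `DyadicRigidManinLaw`,
`TameIrreducibleUnitExcess`), the leaf `ManinCongruenceDefectLaw` (E-desc-2; only its inequality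
shape is used, the leaf is not imported), Agashe–Ribet–Stein 2012 Conj. 2.2 (tree `@[conjecture]`
`AgasheRibetStein2012_conjecture`, shape only) and the tree's named fact
`edixhoven_not_dvd_maninConstant_of_kodairaSymbol_ne` (Edixhoven 1991 Thm. 3, Kodaira-type half).
The first three are VERBATIM the planner's kernel-checked edges (HOME
`run/shared/lean/pub/bsd-f2-manin/desc/Sketch-desc-g2.lean` sha16 2249256900ee85ff:
`tameRigidNoExcess_of_tameRigidManinLaw`, `dyadicRigidExcessLaw_of_dyadicRigidManinLaw`,
`maninCongruenceDefect_two_slack_of_dyadicRigidManinLaw`, with the helper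
`rigidDyadicExcess_add_one : v / 2 - 1 + 1 = v / 2` for `2 ≤ v` inlined as `omega`); the last two
make refuter-2's placement of E-desc-14 («SPLIT: the Manin conjunct at `p > 7` on the rigid stratum
is Edixhoven 1991 Thm. 3», v6 §Q⁶) and of E-desc-18 («equality in ARS Conj. 2.2 on the irreducible
II/III/IV stratum») kernel-checked. Nothing new is asserted: every theorem takes the laws it uses as
explicit hypotheses.
-/

noncomputable section

open scoped MatrixGroups ModularForm

open CongruenceSubgroup WeierstrassCurve
  Literature.NumberTheory.EllipticCurves Literature.NumberTheory.EllipticCurves.ModularForms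
  Literature.NumberTheory.DiophantineGeometry

namespace Summit.BirchSwinnertonDyer.Rank1Residual.ManinAdditive

/-- Placement edge (PROVED, elementary): the Manin-bearing law E-desc-14 is E-desc-14♭ plus the
rigid tame case of Manin's conjecture. [folklore] -/
theorem tameRigidNoExcess_of_tameRigidManinLaw (h : TameRigidManinLaw) : TameRigidNoExcess := by
  intro W _ _ _ D hL hmin p hp hv hK hI
  exact (h W D hL hmin p hp hv hK hI).2

/-- Placement edge (PROVED, elementary): E-desc-17 is E-desc-15 plus the rigid dyadic case of
Manin's conjecture. [folklore] -/
theorem dyadicRigidExcessLaw_of_dyadicRigidManinLaw (h : DyadicRigidManinLaw) :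
    DyadicRigidExcessLaw := by
  intro W _ _ _ D hL hmin hK
  exact (h W D hL hmin hK).2

/-- Placement edge (PROVED, elementary): on a rigid dyadic optimal curve with `v₂(N) ≥ 2`,
E-desc-17 gives the inequality of E-desc-2 `ManinCongruenceDefectLaw` at `p = 2` with SLACK TWO,
i.e. `2·(ord₂ c_E + v₂ r_E) + 2 ≤ 2·v₂ m_E + v₂ N` (E-desc-2 itself allows equality). [folklore] -/
theorem maninCongruenceDefect_two_slack_of_dyadicRigidManinLaw (h : DyadicRigidManinLaw)
    (W : WeierstrassCurve ℚ) [W.IsElliptic] [W.IsGloballyMinimal] [NeZero (W.conductorNorm ℤ)]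
    (D : ModularParametrizationData W (W.conductorNorm ℤ))
    (hL : ∀ z ∈ D.L.lattice, ∃ w ∈ periodLattice D.f, z = D.c * w)
    (hmin : ∀ (W' : WeierstrassCurve ℚ) [W'.IsElliptic]
        (D' : ModularParametrizationData W' (W.conductorNorm ℤ)),
        D'.f = D.f → D.modularDegree ≤ D'.modularDegree)
    (hK : W.kodairaSymbolAt ((Rat.HeightOneSpectrum.primesEquiv (R := ℤ)).symm ⟨2, Nat.prime_two⟩) =
        KodairaSymbol.IIstar ∨
      W.kodairaSymbolAt ((Rat.HeightOneSpectrum.primesEquiv (R := ℤ)).symm ⟨2, Nat.prime_two⟩) =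
        KodairaSymbol.IIIstar ∨
      W.kodairaSymbolAt ((Rat.HeightOneSpectrum.primesEquiv (R := ℤ)).symm ⟨2, Nat.prime_two⟩) =
        KodairaSymbol.IVstar)
    (hv : 2 ≤ padicValNat 2 (W.conductorNorm ℤ)) :
    2 * (padicValInt 2 D.maninConstant + padicValNat 2 (congruenceNumber D.f)) + 2 ≤
      2 * padicValNat 2 D.modularDegree + padicValNat 2 (W.conductorNorm ℤ) := by
  obtain ⟨hc, hx⟩ := h W D hL hmin hK
  have h0 : padicValInt 2 D.maninConstant = 0 := padicValInt.eq_zero_of_not_dvd hc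
  rw [h0, hx]; omega

/-- Placement edge (PROVED): the Manin conjunct of E-desc-14 `TameRigidManinLaw` at a prime
`p > 7` is IN PRINT — a rigid Kodaira type (`II*`, `III*`, `IV*`, `Iₙ*`) is none of `II`, `III`,
`IV`, so Edixhoven 1991 Thm. 3 (Kodaira-type half, tree fact
`edixhoven_not_dvd_maninConstant_of_kodairaSymbol_ne`, taken as a hypothesis) gives `p ∤ c_E` for
the optimal datum, with no hypothesis on `v_p(N)` or on `E[p]`.
[cite: EdixhovenManin1991, Thm. 3] -/
theorem tameRigid_not_dvd_maninConstant_of_edixhoven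
    (hE : edixhoven_not_dvd_maninConstant_of_kodairaSymbol_ne)
    (W : WeierstrassCurve ℚ) [W.IsElliptic] [W.IsGloballyMinimal] [NeZero (W.conductorNorm ℤ)]
    (D : ModularParametrizationData W (W.conductorNorm ℤ))
    (hL : ∀ z ∈ D.L.lattice, ∃ w ∈ periodLattice D.f, z = D.c * w)
    (p : ℕ) (hp : p.Prime) (h7 : 7 < p)
    (hK : W.kodairaSymbolAt ((Rat.HeightOneSpectrum.primesEquiv (R := ℤ)).symm ⟨p, hp⟩) =
          KodairaSymbol.IIstar ∨
        W.kodairaSymbolAt ((Rat.HeightOneSpectrum.primesEquiv (R := ℤ)).symm ⟨p, hp⟩) =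
          KodairaSymbol.IIIstar ∨
        W.kodairaSymbolAt ((Rat.HeightOneSpectrum.primesEquiv (R := ℤ)).symm ⟨p, hp⟩) =
          KodairaSymbol.IVstar ∨
        ∃ n, n ≠ 0 ∧
          W.kodairaSymbolAt ((Rat.HeightOneSpectrum.primesEquiv (R := ℤ)).symm ⟨p, hp⟩) =
            KodairaSymbol.Istar n) :
    ¬ (p : ℤ) ∣ D.maninConstant := by
  rcases hK with h | h | h | ⟨n, -, h⟩ <;>
    exact hE W D hL p hp h7 (by rw [h]; rintro ⟨⟩) (by rw [h]; rintro ⟨⟩) (by rw [h]; rintro ⟨⟩)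

/-- Placement edge (PROVED): at a prime `p > 7`, E-desc-14 `TameRigidManinLaw` follows from its
data half E-desc-14♭ `TameRigidNoExcess` and Edixhoven 1991 Thm. 3 (tree fact
`edixhoven_not_dvd_maninConstant_of_kodairaSymbol_ne`, as a hypothesis): refuter-2's placement
«E-desc-14 SPLIT — Manin conjunct at `p > 7` in print, the rest not» made kernel-checked.
[cite: EdixhovenManin1991, Thm. 3] -/
theorem tameRigidManinLaw_of_gt_seven (hE : edixhoven_not_dvd_maninConstant_of_kodairaSymbol_ne)
    (h14 : TameRigidNoExcess)
    (W : WeierstrassCurve ℚ) [W.IsElliptic] [W.IsGloballyMinimal] [NeZero (W.conductorNorm ℤ)]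
    (D : ModularParametrizationData W (W.conductorNorm ℤ))
    (hL : ∀ z ∈ D.L.lattice, ∃ w ∈ periodLattice D.f, z = D.c * w)
    (hmin : ∀ (W' : WeierstrassCurve ℚ) [W'.IsElliptic]
        (D' : ModularParametrizationData W' (W.conductorNorm ℤ)),
        D'.f = D.f → D.modularDegree ≤ D'.modularDegree)
    (p : ℕ) (hp : p.Prime) (h7 : 7 < p) (hv : padicValNat p (W.conductorNorm ℤ) = 2)
    (hK : W.kodairaSymbolAt ((Rat.HeightOneSpectrum.primesEquiv (R := ℤ)).symm ⟨p, hp⟩) =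
          KodairaSymbol.IIstar ∨
        W.kodairaSymbolAt ((Rat.HeightOneSpectrum.primesEquiv (R := ℤ)).symm ⟨p, hp⟩) =
          KodairaSymbol.IIIstar ∨
        W.kodairaSymbolAt ((Rat.HeightOneSpectrum.primesEquiv (R := ℤ)).symm ⟨p, hp⟩) =
          KodairaSymbol.IVstar ∨
        ∃ n, n ≠ 0 ∧
          W.kodairaSymbolAt ((Rat.HeightOneSpectrum.primesEquiv (R := ℤ)).symm ⟨p, hp⟩) =
            KodairaSymbol.Istar n)
    (hI : (∃ n, W.kodairaSymbolAt ((Rat.HeightOneSpectrum.primesEquiv (R := ℤ)).symm ⟨p, hp⟩) =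
          KodairaSymbol.Istar n) → W.HasIrreducibleModPGaloisRep p) :
    ¬ (p : ℤ) ∣ D.maninConstant ∧
      padicValNat p (congruenceNumber D.f) = padicValNat p D.modularDegree :=
  ⟨tameRigid_not_dvd_maninConstant_of_edixhoven hE W D hL p hp h7 hK,
    h14 W D hL hmin p hp hv hK hI⟩

/-- Placement edge (PROVED, elementary): on its stratum (prime `p ≥ 3`, `v_p(N) = 2`, Kodaira type
`II`, `III` or `IV` at `p`, `E[p]` irreducible) E-desc-18 `TameIrreducibleUnitExcess` gives
Agashe–Ribet–Stein 2012 Conj. 2.2 (tree `AgasheRibetStein2012_conjecture`, shape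
`2·ord_p(r_E) ≤ 2·ord_p(m_E) + ord_p(N)`) WITH EQUALITY: `2·ord_p(r_E) = 2·ord_p(m_E) + ord_p(N)`.
[cite: AgasheRibetStein2012, Conj. 2.2 (shape only)] -/
theorem two_mul_padicValNat_congruenceNumber_eq_of_tameIrreducibleUnitExcess
    (h : TameIrreducibleUnitExcess)
    (W : WeierstrassCurve ℚ) [W.IsElliptic] [W.IsGloballyMinimal] [NeZero (W.conductorNorm ℤ)]
    (D : ModularParametrizationData W (W.conductorNorm ℤ))
    (hL : ∀ z ∈ D.L.lattice, ∃ w ∈ periodLattice D.f, z = D.c * w)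
    (hmin : ∀ (W' : WeierstrassCurve ℚ) [W'.IsElliptic]
        (D' : ModularParametrizationData W' (W.conductorNorm ℤ)),
        D'.f = D.f → D.modularDegree ≤ D'.modularDegree)
    (p : ℕ) (hp : p.Prime) (h3 : 3 ≤ p) (hv : padicValNat p (W.conductorNorm ℤ) = 2)
    (hK : W.kodairaSymbolAt ((Rat.HeightOneSpectrum.primesEquiv (R := ℤ)).symm ⟨p, hp⟩) =
          KodairaSymbol.II ∨
        W.kodairaSymbolAt ((Rat.HeightOneSpectrum.primesEquiv (R := ℤ)).symm ⟨p, hp⟩) =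
          KodairaSymbol.III ∨
        W.kodairaSymbolAt ((Rat.HeightOneSpectrum.primesEquiv (R := ℤ)).symm ⟨p, hp⟩) =
          KodairaSymbol.IV)
    (hI : W.HasIrreducibleModPGaloisRep p) :
    2 * padicValNat p (congruenceNumber D.f) =
      2 * padicValNat p D.modularDegree + padicValNat p (W.conductorNorm ℤ) := by
  rw [h W D hL hmin p hp h3 hv hK hI, hv]; ring

end Summit.BirchSwinnertonDyer.Rank1Residual.ManinAdditive

end
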